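import Summits.NavierStokesRegularity.NavierStokesRegularity.Theses.AxisymmetricExtremality
import Summits.NavierStokesRegularity.NavierStokesRegularity.Theorems.AxisymmetricExtremalityMinimalDatumPFoldThresholdFinite
import Summits.NavierStokesRegularity.NavierStokesRegularity.Theorems.AxisymmetricExtremalityMinimalDatumPFoldNotAeZero
import Summits.NavierStokesRegularity.NavierStokesRegularity.Theorems.AxisymmetricExtremalityMinimalDatumPFoldRecentre
import Summits.NavierStokesRegularity.NavierStokesRegularity.Theorems.AxisymmetricExtremalityMinimalDatumPFoldAeToExact
import Summits.NavierStokesRegularity.NavierStokesRegularity.Theorems.AxisymmetricExtremalityMinimalDatumPFoldScaleRigidity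
import Summits.NavierStokesRegularity.NavierStokesRegularity.Theorems.AxisymmetricExtremalityMinimalDatumPFoldShiftRigidity
import Summits.NavierStokesRegularity.NavierStokesRegularity.Theorems.AxisymmetricExtremalityMinimalDatumPFoldNearMinimalLimit
import Summits.NavierStokesRegularity.NavierStokesRegularity.Theorems.AxisymmetricExtremalityMinimalDatumPFoldSymmetryDefectInLimit

/-!
# Line `symmetric-gap` — crux `MinimalDatumPFold` (stmt-NavierStokesRegularity-15452)

STATUS (lead c1, cycle 2, 2026-08-17): `stub_nearMinimalLimit` LANDED (p151693,
`Theorems/AxisymmetricExtremalityMinimalDatumPFoldNearMinimalLimit.lean`) and `stub_symmetryDefectInLimit`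
LANDED (p151913, `Theorems/AxisymmetricExtremalityMinimalDatumPFoldSymmetryDefectInLimit.lean`); both are
discharged below BY NAME. The ONLY sorry left is `stub_symmGapClosing` (the open content: ρ_p = ρ_max in
infimum form).
## route-NavierStokesRegularity-AxisymmetricExtremality · crux-strategist alt line (planner-cstrat-…-15452-b1-0, 2026-08-17)

**Idea (equivariant direct method at the global threshold; organising quantity = the 2001 "gap
sequence" `ρ_p := inf {‖u₀‖_{Ḣ^{1/2}} : u₀ p-fold symmetric about the x₂-axis, T_max(u₀) < ∞}`).**
The crux says: Clay failure at `ν` ⇒ for unboundedly many `p` there is an EXACTLY `p`-fold symmetric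
Rusin–Šverák MINIMAL blow-up datum (norm exactly `ρ_max^pure(ν)`). The registered line `birth`
obtains it as a Smith fixed point on `M̂ = M/Sim` (needs `F_p`-acyclicity of `M̂`, no source; no Čech
cohomology / Smith theory in Mathlib). This line removes ATTAINMENT from the open content: by the
Rusin–Šverák weak-limit blow-up (PROVED in tree: `rusin_sverak_weak_limit_blowup_holds`) + weak
compactness + Radon–Riesz, any sequence of p-fold symmetric blow-up data whose norms tend to
`ρ_max^pure` has, after modulation by `Sim`, an `L³`-limit in `M` (`stub_nearMinimalLimit`); the
symmetry survives the limit as symmetry about a possibly SHIFTED vertical axis, because an escaping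
axis would force the limit to vanish (`stub_symmetryDefectInLimit`, pure `L³` real analysis in the
style of the landed rigidity stubs); the landed `stub_liftRecentre` and `stub_liftAeToExact`
finish (both LANDED, used by name). What is left — the ONE stub carrying open mathematics — is the INFIMUM form of extremality:

  `stub_symmGapClosing`: Clay failure at `ν` ⇒ ∀ N ∃ p ≥ max(N,2) ∀ ε > 0 ∃ an a.e.-`R_{2π/p}`-equivariant
  blow-up datum (`L³`, represented in `Ḣ^{1/2}`, weakly div-free, no global Kato solution) of norm
  `< ρ_max^pure(ν) + ε`  — i.e. `ρ_p = ρ_max` as an INFIMUM, for unboundedly many `p`.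

It is implied by `birth`'s `stub_smithFixedModSim` + the landed lift — KERNEL-CHECKED below as
`symmGapClosing_of_smithFixedModSim` (sorry-free) — so this line weakly dominates `birth`; unlike the fixed-point form it admits APPROXIMATE constructions (ε of slack in the critical
norm, a.e. symmetry, no minimality to certify) and needs no topology of `M̂`. Honest status: no tool
is known to produce cheap symmetric blow-up from blow-up (necklaces of `p` far copies cost `√p·ρ_max`
and are not even known to blow up: threshold blow-up is nowhere known to be robust); the stub is
irrefutable short of `¬Clay` (its antecedent). See `Lines/symmetric-gap.md` and `STRATEGY-CENSUS.md`.

Typing: the rotation `R_{2π/p}` about the `x₂`-axis is WRITTEN OUT exactly as in the route file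
(`rotZ (2π/p)` unfolded), so this file imports only the route file and the landed stub files of `birth`
that it re-uses BY NAME (`stub_thresholdFinite_of_clayFailure` p147201, `stub_minimalDatum_not_aeZero` p146958,
`stub_liftRecentre` p147155, `stub_liftAeToExact` p149205; `stub_liftScaleRigidity` p147324 and
`stub_liftShiftRigidity` p148584 only for the dominance theorem). Three stubs, one open.
Disproof used: none exists for this crux (`ledger crux ls`: no `Disproof.lean`, no `Negative/`).
-/

set_option linter.dupNamespace false

namespace Summit.NavierStokesRegularity.NavierStokesRegularity.Cruxes.MinimalDatumPFold.SymmetricGap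

/-- **THE LOAD-BEARING STUB — symmetric gap closing, infimum form (size XL / open; NEW).**
For `ν > 0`: if Clay (A) fails at viscosity `ν` (verbatim the crux's antecedent), then for every `N`
there is `p ≥ max(N,2)` such that for every `ε > 0` some blow-up datum `(u₀, g)` — `u₀ ∈ L³`, `g ∈ Ḣ^{1/2}`
representing `complexify ∘ u₀`, weakly divergence-free, WITHOUT a global Kato solution — has
`‖g‖ < ρ_max^pure(ν) + ε` and is a.e. equivariant under the rotation `R_{2π/p}` about the `x₂`-axis.
Equivalently `ρ_p(ν) = ρ_max^pure(ν)` where `ρ_p` is the threshold of the closed, flow-invariant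
`p`-fold symmetric class (2001 gap sequence: `ρ_p ∈ [ρ_max, ∞]`, `ρ_p ≤ ρ_q` for `p ∣ q`). Why it might
be provable: it is the weakest form of "symmetry is free at the threshold" — no attainment, no exact
symmetry, ε of slack for gluing/perturbative constructions; it follows from `birth`'s Smith stub. Why it
might fail: in a blow-up world symmetric blow-up may be strictly dearer (`ρ_p > ρ_max` for all large
`p`) — generic minimal data need not be symmetric and no symmetrisation preserving blow-up is known;
irrefutable short of `¬Clay`. [sources: RusinSverak2011 Cor 4.3; arXiv:1012.0145 Thm 9; JiaSverak2013;
arXiv:0804.1124 (sibling: minimal-mass NLS blow-up is the symmetric ground state); prior programme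
summits/ns/routes/minimal-blowup-symmetry (gap sequence, claim-level)] -/
theorem stub_symmGapClosing :
    ∀ ν : ℝ, 0 < ν → (∃ v₀ : EuclideanSpace ℝ (Fin 3) → EuclideanSpace ℝ (Fin 3), ContDiff ℝ (⊤ : ℕ∞) v₀ ∧ Literature.Analysis.FluidPDE.NSWave0.IsDivFree v₀ ∧ Literature.Analysis.FluidPDE.HasRapidSpatialDecay v₀ ∧ ¬ ∃ (u : ℝ → EuclideanSpace ℝ (Fin 3) → EuclideanSpace ℝ (Fin 3)) (p : ℝ → EuclideanSpace ℝ (Fin 3) → ℝ), Literature.Analysis.FluidPDE.IsSmoothOnHalfSpace u ∧ Literature.Analysis.FluidPDE.IsSmoothOnHalfSpace p ∧ Literature.Analysis.FluidPDE.IsNavierStokesSolution ν 0 v₀ u p ∧ Literature.Analysis.FluidPDE.HasBoundedEnergy u) → ∀ N : ℕ, ∃ p : ℕ, N ≤ p ∧ 2 ≤ p ∧ ∀ ε : ENNReal, 0 < ε → ∃ (u₀ : EuclideanSpace ℝ (Fin 3) → EuclideanSpace ℝ (Fin 3)) (g : Literature.Analysis.FunctionSpaces.HomSobolev (EuclideanSpace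 ℝ (Fin 3)) (EuclideanSpace ℂ (Fin 3)) (1 / 2 : ℝ)), MeasureTheory.MemLp u₀ 3 (MeasureTheory.volume : MeasureTheory.Measure (EuclideanSpace ℝ (Fin 3))) ∧ g.Represents (Literature.Analysis.FunctionSpaces.EuclideanSpace.complexify ∘ u₀) ∧ Literature.Analysis.FluidPDE.IsWeaklyDivFree u₀ ∧ ¬ Literature.Analysis.FluidPDE.HasGlobalKatoSolution ν u₀ ∧ ‖g‖ₑ < Literature.Analysis.FluidPDE.rusinSverakRhoMaxPure ν + ε ∧ ∀ᵐ x ∂(MeasureTheory.volume : MeasureTheory.Measure (EuclideanSpace ℝ (Fin 3))), u₀ (WithLp.toLp 2 ![Real.cos (2 * Real.pi / p) * x 0 - Real.sin (2 * Real.pi / p) * x 1, Real.sin (2 * Real.pi / p) * x 0 + Real.cos (2 * Real.pi / p) * x 1, x 2]) = WithLp.toLp 2 ![Real.cos (2 * Real.pi / p) * u₀ x 0 - Real.sin (2 * Real.pi / p) * u₀ x 1, Real.sin (2 * Real.pi / p) * u₀ x 0 + Real.cos (2 * Real.pi / p) * u₀ x 1, u₀ x 2] := by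
  sorry

/-- **Near-minimal blow-up sequences have minimal `L³`-limits modulo `Sim` (size M–L; provable now).**
For `ν > 0` with `ρ_max^pure(ν) < ⊤`: a sequence of blow-up data `(U k, G k)` with
`‖G k‖ < ρ_max^pure(ν) + 1/(k+1)` admits scales `lam j > 0`, centres `x₀ j`, a subsequence `φ` and a
MINIMAL blow-up datum `(u, g)` with `lam j • U (φ j) (lam j • x - x₀ j) → u` in `L³`. Proof (the tree's
proof of `stub_compactModuloSim` / `rusin_sverak_minimal_data_compact_of_weak_limit_blowup` with
`‖G k‖ → ρ` in place of `= ρ`): blow-up ⇒ `‖G k‖ ≥ ρ` (`hasGlobalKatoSolution_of_lt_rusinSverakRhoMaxPure`);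
`rusin_sverak_weak_limit_blowup_holds` gives the modulation; the modulated classes
(`exists_represents_rescaleData_norm_eq`, same norms) are bounded, so a subsequence converges weakly
(`exists_strictMono_tendsto_inner`) to `glim` representing a blow-up datum `u`; `ρ ≤ ‖glim‖` (threshold)
and `‖glim‖ ≤ liminf ‖G (φ n)‖ = ρ` (weak l.s.c.), so `(u, glim) ∈ M`; Radon–Riesz with converging norms
(`‖x_n - a‖² = ‖x_n‖² - 2 Re⟪x_n, a⟫ + ‖a‖² → 0`, cf. `tendsto_of_tendsto_inner_of_norm_eq`) gives strong
`Ḣ^{1/2}` convergence, and `eLpNorm_three_sub_le_of_represents` (`Represents.sub` + BCD Thm 1.38) the `L³`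
convergence. [sources: RusinSverak2011 Cor 4.3 and its proof p. 8; arXiv:1012.0145 Thm 9;
BahouriCheminDanchin2011 Thm 1.38] -/
theorem stub_nearMinimalLimit :
    ∀ ν : ℝ, 0 < ν → Literature.Analysis.FluidPDE.rusinSverakRhoMaxPure ν < ⊤ → ∀ (U : ℕ → EuclideanSpace ℝ (Fin 3) → EuclideanSpace ℝ (Fin 3)) (G : ℕ → Literature.Analysis.FunctionSpaces.HomSobolev (EuclideanSpace ℝ (Fin 3)) (EuclideanSpace ℂ (Fin 3)) (1 / 2 : ℝ)), (∀ k : ℕ, MeasureTheory.MemLp (U k) 3 (MeasureTheory.volume : MeasureTheory.Measure (EuclideanSpace ℝ (Fin 3))) ∧ (G k).Represents (Literature.Analysis.FunctionSpaces.EuclideanSpace.complexify ∘ (U k)) ∧ Literature.Analysis.FluidPDE.IsWeaklyDivFree (U k) ∧ ¬ Literature.Analysis.FluidPDE.HasGlobalKatoSolution ν (U k) ∧ ‖G k‖ₑ < Literature.Analysis.FluidPDE.rusinSverakRhoMaxPure ν + ((k : ENNReal) + 1)⁻¹) → ∃ (lam : ℕ → ℝ) (x₀ : ℕ → EuclideanSpace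 ℝ (Fin 3)) (φ : ℕ → ℕ) (u : EuclideanSpace ℝ (Fin 3) → EuclideanSpace ℝ (Fin 3)) (g : Literature.Analysis.FunctionSpaces.HomSobolev (EuclideanSpace ℝ (Fin 3)) (EuclideanSpace ℂ (Fin 3)) (1 / 2 : ℝ)), (∀ j, 0 < lam j) ∧ StrictMono φ ∧ Literature.Analysis.FluidPDE.IsMinimalBlowupDatum ν u g ∧ Filter.Tendsto (fun j => MeasureTheory.eLpNorm (Literature.Analysis.FluidPDE.rescaleData (lam j) (fun x => U (φ j) (x - x₀ j)) - u) 3 (MeasureTheory.volume : MeasureTheory.Measure (EuclideanSpace ℝ (Fin 3)))) Filter.atTop (nhds 0) :=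
  -- LANDED (p151693, lead c1 wave 2)
  Summit.NavierStokesRegularity.NavierStokesRegularity.Theorems.stub_nearMinimalLimit

/-- **Discrete rotational symmetry passes to modulated `L³`-limits up to a horizontal shift of the
axis (size M; pure real analysis, provable now).** Let `U j ∈ L³` be a.e. `R`-equivariant
(`R = R_{2π/p}` about the `x₂`-axis, written out), `lam j > 0`, `x₀ j ∈ ℝ³`, and suppose the modulated
fields `v_j := lam j • U j (lam j • x - x₀ j)` converge in `L³` to `u ∈ L³`, `u` not a.e. zero. Then
`u (R x - x₁) = R (u x)` a.e. for some HORIZONTAL `x₁` (`x₁ 2 = 0`) — exactly the hypothesis of the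
landed `stub_liftRecentre`. Proof: `R` is linear, so `v_j (R x) = R (v_j (x + c_j))` a.e. with
`lam j • c_j = x₀ j - R⁻¹ (x₀ j)`, `(c_j) 2 = 0`. If `(c_j)` has a bounded subsequence, pass to a limit
`c` (continuity of translations in `L³`, `R` measure-preserving): `u (R x) = R (u (x + c))` a.e., i.e.
`u (R x - R c) = R (u x)` with `x₁ := R c` horizontal. If `‖c_j‖ → ∞`: for every ball `B`,
`‖u ∘ R‖_{L³(B)} = lim ‖v_j (· + c_j)‖_{L³(B)} ≤ lim (‖v_j - u‖₃ + ‖u‖_{L³(B + c_j)}) = 0` (tails of an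
`L³` function), so `u = 0` a.e. — excluded. (Cf. the landed `MotionTools` of crux PFoldToAxisymmetric:
`tendsto_eLpNorm_comp_motion_sub`, `tendsto_lintegral_ball_of_tendsto_norm_atTop`,
`eLpNorm_eq_zero_of_tendsto_motion_of_norm_ge`.) [sources: RusinSverak2011 §1 p. 3 (the group Sim);
folklore] -/
theorem stub_symmetryDefectInLimit :
    ∀ (p : ℕ) (U : ℕ → EuclideanSpace ℝ (Fin 3) → EuclideanSpace ℝ (Fin 3)) (lam : ℕ → ℝ) (x₀ : ℕ → EuclideanSpace ℝ (Fin 3)) (u : EuclideanSpace ℝ (Fin 3) → EuclideanSpace ℝ (Fin 3)), (∀ j, MeasureTheory.MemLp (U j) 3 (MeasureTheory.volume : MeasureTheory.Measure (EuclideanSpace ℝ (Fin 3)))) → (∀ j, ∀ᵐ x ∂(MeasureTheory.volume : MeasureTheory.Measure (EuclideanSpace ℝ (Fin 3))), U j (WithLp.toLp 2 ![Real.cos (2 * Real.pi / p) * x 0 - Real.sin (2 * Real.pi / p) * x 1, Real.sin (2 * Real.pi / p) * x 0 + Real.cos (2 * Real.pi / p) * x 1, x 2]) = WithLp.toLp 2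 ![Real.cos (2 * Real.pi / p) * U j x 0 - Real.sin (2 * Real.pi / p) * U j x 1, Real.sin (2 * Real.pi / p) * U j x 0 + Real.cos (2 * Real.pi / p) * U j x 1, U j x 2]) → (∀ j, 0 < lam j) → MeasureTheory.MemLp u 3 (MeasureTheory.volume : MeasureTheory.Measure (EuclideanSpace ℝ (Fin 3))) → ¬ (u =ᵐ[(MeasureTheory.volume : MeasureTheory.Measure (EuclideanSpace ℝ (Fin 3)))] (0 : EuclideanSpace ℝ (Fin 3) → EuclideanSpace ℝ (Fin 3))) → Filter.Tendsto (fun j => MeasureTheory.eLpNorm (Literature.Analysis.FluidPDE.rescaleData (lam j) (fun x => U j (x - x₀ j)) - u) 3 (MeasureTheory.volume : MeasureTheory.Measure (EuclideanSpace ℝ (Fin 3)))) Filter.atTop (nhds 0) → ∃ x₁ : EuclideanSpace ℝ (Fin 3), x₁ 2 = 0 ∧ ∀ᵐ x ∂(MeasureTheory.volume : MeasureTheory.Measure (EuclideanSpace ℝ (Fin 3))), u (WithLp.toLp 2 ![Real.cos (2 * Real.pi / p) * x 0 - Real.sin (2 * Real.pi / p) * x 1, Real.sin (2 * Real.pi /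 p) * x 0 + Real.cos (2 * Real.pi / p) * x 1, x 2] - x₁) = WithLp.toLp 2 ![Real.cos (2 * Real.pi / p) * u x 0 - Real.sin (2 * Real.pi / p) * u x 1, Real.sin (2 * Real.pi / p) * u x 0 + Real.cos (2 * Real.pi / p) * u x 1, u x 2] :=
  -- LANDED (p151913, lead c1 wave 2)
  Summit.NavierStokesRegularity.NavierStokesRegularity.Theorems.stub_symmetryDefectInLimit

/-- COMPOSITION (kernel-checked, no sorry): the three stub SIGNATURES, together with the four LANDED
stubs of line `birth` used by name (`stub_thresholdFinite_of_clayFailure`, `stub_minimalDatum_not_aeZero`,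
`stub_liftRecentre`, `stub_liftAeToExact`), imply the crux written out. Given `ν > 0`, a Clay failure and `N`: the threshold
is finite (landed); gap closing gives `p ≥ max(N,2)` and, with `ε = 1/(k+1)`, a sequence of a.e.
`R_{2π/p}`-equivariant blow-up data with norms `< ρ + 1/(k+1)`; `stub_nearMinimalLimit` extracts a
modulated `L³`-limit `(u, g) ∈ M`; `u` is not a.e. zero (landed); `stub_symmetryDefectInLimit` makes `u`
equivariant up to a horizontal shift; `stub_liftRecentre` (landed) recentres; `stub_liftAeToExact` (landed)
makes the equivariance exact. -/
theorem MinimalDatumPFold_of_sigs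
    (hA : ∀ ν : ℝ, 0 < ν → (∃ v₀ : EuclideanSpace ℝ (Fin 3) → EuclideanSpace ℝ (Fin 3), ContDiff ℝ (⊤ : ℕ∞) v₀ ∧ Literature.Analysis.FluidPDE.NSWave0.IsDivFree v₀ ∧ Literature.Analysis.FluidPDE.HasRapidSpatialDecay v₀ ∧ ¬ ∃ (u : ℝ → EuclideanSpace ℝ (Fin 3) → EuclideanSpace ℝ (Fin 3)) (p : ℝ → EuclideanSpace ℝ (Fin 3) → ℝ), Literature.Analysis.FluidPDE.IsSmoothOnHalfSpace u ∧ Literature.Analysis.FluidPDE.IsSmoothOnHalfSpace p ∧ Literature.Analysis.FluidPDE.IsNavierStokesSolution ν 0 v₀ u p ∧ Literature.Analysis.FluidPDE.HasBoundedEnergy u) → ∀ N : ℕ, ∃ p : ℕ, N ≤ p ∧ 2 ≤ p ∧ ∀ ε : ENNReal, 0 < ε → ∃ (u₀ : EuclideanSpace ℝ (Fin 3) → EuclideanSpace ℝ (Fin 3)) (g : Literature.Analysis.FunctionSpaces.HomSobolev (EuclideanSpace ℝ (Fin 3)) (EuclideanSpace ℂ (Fin 3)) (1 / 2 : ℝ)),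 MeasureTheory.MemLp u₀ 3 (MeasureTheory.volume : MeasureTheory.Measure (EuclideanSpace ℝ (Fin 3))) ∧ g.Represents (Literature.Analysis.FunctionSpaces.EuclideanSpace.complexify ∘ u₀) ∧ Literature.Analysis.FluidPDE.IsWeaklyDivFree u₀ ∧ ¬ Literature.Analysis.FluidPDE.HasGlobalKatoSolution ν u₀ ∧ ‖g‖ₑ < Literature.Analysis.FluidPDE.rusinSverakRhoMaxPure ν + ε ∧ ∀ᵐ x ∂(MeasureTheory.volume : MeasureTheory.Measure (EuclideanSpace ℝ (Fin 3))), u₀ (WithLp.toLp 2 ![Real.cos (2 * Real.pi / p) * x 0 - Real.sin (2 * Real.pi / p) * x 1, Real.sin (2 * Real.pi / p) * x 0 + Real.cos (2 * Real.pi / p) * x 1, x 2]) = WithLp.toLp 2 ![Real.cos (2 * Real.pi / p) * u₀ x 0 - Real.sin (2 * Real.pi / p) * u₀ x 1, Real.sin (2 * Real.pi / p) * u₀ x 0 + Real.cos (2 * Real.pi / p) * u₀ x 1, u₀ x 2])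
    (hB : ∀ ν : ℝ, 0 < ν → Literature.Analysis.FluidPDE.rusinSverakRhoMaxPure ν < ⊤ → ∀ (U : ℕ → EuclideanSpace ℝ (Fin 3) → EuclideanSpace ℝ (Fin 3)) (G : ℕ → Literature.Analysis.FunctionSpaces.HomSobolev (EuclideanSpace ℝ (Fin 3)) (EuclideanSpace ℂ (Fin 3)) (1 / 2 : ℝ)), (∀ k : ℕ, MeasureTheory.MemLp (U k) 3 (MeasureTheory.volume : MeasureTheory.Measure (EuclideanSpace ℝ (Fin 3))) ∧ (G k).Represents (Literature.Analysis.FunctionSpaces.EuclideanSpace.complexify ∘ (U k)) ∧ Literature.Analysis.FluidPDE.IsWeaklyDivFree (U k) ∧ ¬ Literature.Analysis.FluidPDE.HasGlobalKatoSolution ν (U k) ∧ ‖G k‖ₑ < Literature.Analysis.FluidPDE.rusinSverakRhoMaxPure ν + ((k : ENNReal) + 1)⁻¹) → ∃ (lam : ℕ → ℝ) (x₀ : ℕ → EuclideanSpace ℝ (Fin 3)) (φ : ℕ → ℕ) (u : EuclideanSpace ℝ (Fin 3) → EuclideanSpace ℝ (Fin 3)) (g : Literature.Analysis.FunctionSpaces.HomSobolev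 (EuclideanSpace ℝ (Fin 3)) (EuclideanSpace ℂ (Fin 3)) (1 / 2 : ℝ)), (∀ j, 0 < lam j) ∧ StrictMono φ ∧ Literature.Analysis.FluidPDE.IsMinimalBlowupDatum ν u g ∧ Filter.Tendsto (fun j => MeasureTheory.eLpNorm (Literature.Analysis.FluidPDE.rescaleData (lam j) (fun x => U (φ j) (x - x₀ j)) - u) 3 (MeasureTheory.volume : MeasureTheory.Measure (EuclideanSpace ℝ (Fin 3)))) Filter.atTop (nhds 0))
    (hC : ∀ (p : ℕ) (U : ℕ → EuclideanSpace ℝ (Fin 3) → EuclideanSpace ℝ (Fin 3)) (lam : ℕ → ℝ) (x₀ : ℕ → EuclideanSpace ℝ (Fin 3)) (u : EuclideanSpace ℝ (Fin 3) → EuclideanSpace ℝ (Fin 3)), (∀ j, MeasureTheory.MemLp (U j) 3 (MeasureTheory.volume : MeasureTheory.Measure (EuclideanSpace ℝ (Fin 3)))) → (∀ j, ∀ᵐ x ∂(MeasureTheory.volume : MeasureTheory.Measure (EuclideanSpace ℝ (Fin 3))), U j (WithLp.toLp 2 ![Real.cos (2 * Real.pi / p) * x 0 - Real.sin (2 * Real.pi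 / p) * x 1, Real.sin (2 * Real.pi / p) * x 0 + Real.cos (2 * Real.pi / p) * x 1, x 2]) = WithLp.toLp 2 ![Real.cos (2 * Real.pi / p) * U j x 0 - Real.sin (2 * Real.pi / p) * U j x 1, Real.sin (2 * Real.pi / p) * U j x 0 + Real.cos (2 * Real.pi / p) * U j x 1, U j x 2]) → (∀ j, 0 < lam j) → MeasureTheory.MemLp u 3 (MeasureTheory.volume : MeasureTheory.Measure (EuclideanSpace ℝ (Fin 3))) → ¬ (u =ᵐ[(MeasureTheory.volume : MeasureTheory.Measure (EuclideanSpace ℝ (Fin 3)))] (0 : EuclideanSpace ℝ (Fin 3) → EuclideanSpace ℝ (Fin 3))) → Filter.Tendsto (fun j => MeasureTheory.eLpNorm (Literature.Analysis.FluidPDE.rescaleData (lam j) (fun x => U j (x - x₀ j)) - u) 3 (MeasureTheory.volume : MeasureTheory.Measure (EuclideanSpace ℝ (Fin 3)))) Filter.atTop (nhds 0) → ∃ x₁ : EuclideanSpace ℝ (Fin 3), x₁ 2 = 0 ∧ ∀ᵐ x ∂(MeasureTheory.volume : MeasureTheory.Measure (EuclideanSpace ℝ (Fin 3))), u (WithLp.toLp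 2 ![Real.cos (2 * Real.pi / p) * x 0 - Real.sin (2 * Real.pi / p) * x 1, Real.sin (2 * Real.pi / p) * x 0 + Real.cos (2 * Real.pi / p) * x 1, x 2] - x₁) = WithLp.toLp 2 ![Real.cos (2 * Real.pi / p) * u x 0 - Real.sin (2 * Real.pi / p) * u x 1, Real.sin (2 * Real.pi / p) * u x 0 + Real.cos (2 * Real.pi / p) * u x 1, u x 2]) :
    ∀ ν : ℝ, 0 < ν → (∃ v₀ : EuclideanSpace ℝ (Fin 3) → EuclideanSpace ℝ (Fin 3), ContDiff ℝ (⊤ : ℕ∞) v₀ ∧ Literature.Analysis.FluidPDE.NSWave0.IsDivFree v₀ ∧ Literature.Analysis.FluidPDE.HasRapidSpatialDecay v₀ ∧ ¬ ∃ (u : ℝ → EuclideanSpace ℝ (Fin 3) → EuclideanSpace ℝ (Fin 3)) (p : ℝ → EuclideanSpace ℝ (Fin 3) → ℝ), Literature.Analysis.FluidPDE.IsSmoothOnHalfSpace u ∧ Literature.Analysis.FluidPDE.IsSmoothOnHalfSpace p ∧ Literature.Analysis.FluidPDE.IsNavierStokesSolution ν 0 v₀ u p ∧ Literature.Analysis.FluidPDE.HasBoundedEnergy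 u) → ∀ N : ℕ, ∃ p : ℕ, N ≤ p ∧ 2 ≤ p ∧ ∃ (u₀ : EuclideanSpace ℝ (Fin 3) → EuclideanSpace ℝ (Fin 3)) (g : Literature.Analysis.FunctionSpaces.HomSobolev (EuclideanSpace ℝ (Fin 3)) (EuclideanSpace ℂ (Fin 3)) (1 / 2 : ℝ)), Literature.Analysis.FluidPDE.IsMinimalBlowupDatum ν u₀ g ∧ ∀ x : EuclideanSpace ℝ (Fin 3), u₀ (WithLp.toLp 2 ![Real.cos (2 * Real.pi / p) * x 0 - Real.sin (2 * Real.pi / p) * x 1, Real.sin (2 * Real.pi / p) * x 0 + Real.cos (2 * Real.pi / p) * x 1, x 2]) = WithLp.toLp 2 ![Real.cos (2 * Real.pi / p) * u₀ x 0 - Real.sin (2 * Real.pi / p) * u₀ x 1, Real.sin (2 * Real.pi / p) * u₀ x 0 + Real.cos (2 * Real.pi / p) * u₀ x 1, u₀ x 2] := by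
  intro ν hν hclay N
  have hfin : Literature.Analysis.FluidPDE.rusinSverakRhoMaxPure ν < ⊤ :=
    Summit.NavierStokesRegularity.NavierStokesRegularity.Theorems.stub_thresholdFinite_of_clayFailure ν hν hclay
  obtain ⟨p, hNp, h2p, hfam⟩ := hA ν hν hclay N
  have hpos : ∀ k : ℕ, (0 : ENNReal) < ((k : ENNReal) + 1)⁻¹ := fun k =>
    ENNReal.inv_pos.2 (by simp)
  choose U G hU using fun k : ℕ => hfam (((k : ENNReal) + 1)⁻¹) (hpos k)
  obtain ⟨lam, x₀, φ, u, g, hlam, hφ, hmin, htend⟩ := hB ν hν hfin U G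
    (fun k => ⟨(hU k).1, (hU k).2.1, (hU k).2.2.1, (hU k).2.2.2.1, (hU k).2.2.2.2.1⟩)
  have hne := Summit.NavierStokesRegularity.NavierStokesRegularity.Theorems.stub_minimalDatum_not_aeZero ν u g hmin
  have hL3 : MeasureTheory.MemLp u 3 (MeasureTheory.volume : MeasureTheory.Measure (EuclideanSpace ℝ (Fin 3))) := hmin.1
  obtain ⟨x₁, hx₁, hfix⟩ := hC p (fun j => U (φ j)) lam x₀ u (fun j => (hU (φ j)).1)
    (fun j => (hU (φ j)).2.2.2.2.2) hlam hL3 hne htend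
  obtain ⟨u₁, g₁, hmin₁, hfix₁⟩ :=
    Summit.NavierStokesRegularity.NavierStokesRegularity.Theorems.stub_liftRecentre ν p h2p u g hmin x₁ hx₁ hfix
  obtain ⟨u₂, g₂, hmin₂, hsym⟩ :=
    Summit.NavierStokesRegularity.NavierStokesRegularity.Theorems.stub_liftAeToExact ν p h2p u₁ g₁ hmin₁ hfix₁
  exact ⟨p, hNp, h2p, u₂, g₂, hmin₂, hsym⟩

/-- **DOMINANCE over line `birth` (kernel-checked, no sorry).** The signature of `birth`'s one open stub
`stub_smithFixedModSim` (a minimal blow-up datum fixed MODULO Sim by `R_{2π/p}`) implies this line's open stub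
`stub_symmGapClosing`, through the LANDED lift of `birth`: not a.e. zero ⇒ scale rigidity (`lam = 1`) ⇒ shift
rigidity (`(x₀)₂ = 0`) ⇒ recentring gives an a.e.-equivariant MINIMAL datum, whose norm is `ρ_max^pure ν < ρ_max^pure ν + ε`.
So any proof of `birth`'s open stub closes this line too; the converse needs `stub_nearMinimalLimit` +
`stub_symmetryDefectInLimit` (this line's provable stubs). -/
theorem symmGapClosing_of_smithFixedModSim
    (hS : ∀ ν : ℝ, 0 < ν → Literature.Analysis.FluidPDE.rusinSverakRhoMaxPure ν < ⊤ → ∀ N : ℕ, ∃ p : ℕ, N ≤ p ∧ 2 ≤ p ∧ ∃ (u₀ : EuclideanSpace ℝ (Fin 3) → EuclideanSpace ℝ (Fin 3)) (g : Literature.Analysis.FunctionSpaces.HomSobolev (EuclideanSpace ℝ (Fin 3)) (EuclideanSpace ℂ (Fin 3)) (1 / 2 : ℝ)), Literature.Analysis.FluidPDE.IsMinimalBlowupDatum ν u₀ g ∧ ∃ (lam : ℝ) (x₀ : EuclideanSpace ℝ (Fin 3)), 0 < lam ∧ ∀ᵐ x ∂(MeasureTheory.volume : MeasureTheory.Measure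 (EuclideanSpace ℝ (Fin 3))), Literature.Analysis.FluidPDE.rescaleData lam (fun y => u₀ (y - x₀)) (WithLp.toLp 2 ![Real.cos (2 * Real.pi / p) * x 0 - Real.sin (2 * Real.pi / p) * x 1, Real.sin (2 * Real.pi / p) * x 0 + Real.cos (2 * Real.pi / p) * x 1, x 2]) = WithLp.toLp 2 ![Real.cos (2 * Real.pi / p) * u₀ x 0 - Real.sin (2 * Real.pi / p) * u₀ x 1, Real.sin (2 * Real.pi / p) * u₀ x 0 + Real.cos (2 * Real.pi / p) * u₀ x 1, u₀ x 2]) :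
    ∀ ν : ℝ, 0 < ν → (∃ v₀ : EuclideanSpace ℝ (Fin 3) → EuclideanSpace ℝ (Fin 3), ContDiff ℝ (⊤ : ℕ∞) v₀ ∧ Literature.Analysis.FluidPDE.NSWave0.IsDivFree v₀ ∧ Literature.Analysis.FluidPDE.HasRapidSpatialDecay v₀ ∧ ¬ ∃ (u : ℝ → EuclideanSpace ℝ (Fin 3) → EuclideanSpace ℝ (Fin 3)) (p : ℝ → EuclideanSpace ℝ (Fin 3) → ℝ), Literature.Analysis.FluidPDE.IsSmoothOnHalfSpace u ∧ Literature.Analysis.FluidPDE.IsSmoothOnHalfSpace p ∧ Literature.Analysis.FluidPDE.IsNavierStokesSolution ν 0 v₀ u p ∧ Literature.Analysis.FluidPDE.HasBoundedEnergy u) → ∀ N : ℕ, ∃ p : ℕ, N ≤ p ∧ 2 ≤ p ∧ ∀ ε : ENNReal, 0 < ε → ∃ (u₀ : EuclideanSpace ℝ (Fin 3) → EuclideanSpace ℝ (Fin 3)) (g : Literature.Analysis.FunctionSpaces.HomSobolev (EuclideanSpace ℝ (Fin 3)) (EuclideanSpace ℂ (Fin 3)) (1 / 2 : ℝ)), MeasureTheory.MemLp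 u₀ 3 (MeasureTheory.volume : MeasureTheory.Measure (EuclideanSpace ℝ (Fin 3))) ∧ g.Represents (Literature.Analysis.FunctionSpaces.EuclideanSpace.complexify ∘ u₀) ∧ Literature.Analysis.FluidPDE.IsWeaklyDivFree u₀ ∧ ¬ Literature.Analysis.FluidPDE.HasGlobalKatoSolution ν u₀ ∧ ‖g‖ₑ < Literature.Analysis.FluidPDE.rusinSverakRhoMaxPure ν + ε ∧ ∀ᵐ x ∂(MeasureTheory.volume : MeasureTheory.Measure (EuclideanSpace ℝ (Fin 3))), u₀ (WithLp.toLp 2 ![Real.cos (2 * Real.pi / p) * x 0 - Real.sin (2 * Real.pi / p) * x 1, Real.sin (2 * Real.pi / p) * x 0 + Real.cos (2 * Real.pi / p) * x 1, x 2]) = WithLp.toLp 2 ![Real.cos (2 * Real.pi / p) * u₀ x 0 - Real.sin (2 * Real.pi / p) * u₀ x 1, Real.sin (2 * Real.pi / p) * u₀ x 0 + Real.cos (2 * Real.pi / p) * u₀ x 1, u₀ x 2] := by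
  intro ν hν hclay N
  have hfin : Literature.Analysis.FluidPDE.rusinSverakRhoMaxPure ν < ⊤ :=
    Summit.NavierStokesRegularity.NavierStokesRegularity.Theorems.stub_thresholdFinite_of_clayFailure ν hν hclay
  obtain ⟨p, hNp, h2p, u₀, g, hmin, lam, x₀, hlam, hfix⟩ := hS ν hν hfin N
  have hne := Summit.NavierStokesRegularity.NavierStokesRegularity.Theorems.stub_minimalDatum_not_aeZero ν u₀ g hmin
  have hL3 : MeasureTheory.MemLp u₀ 3 (MeasureTheory.volume : MeasureTheory.Measure (EuclideanSpace ℝ (Fin 3))) := hmin.1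
  obtain rfl : lam = 1 :=
    Summit.NavierStokesRegularity.NavierStokesRegularity.Theorems.stub_liftScaleRigidity p u₀ hL3 hne lam x₀ hlam hfix
  have hfix' : ∀ᵐ x ∂(MeasureTheory.volume : MeasureTheory.Measure (EuclideanSpace ℝ (Fin 3))),
      u₀ (WithLp.toLp 2 ![Real.cos (2 * Real.pi / p) * x 0 - Real.sin (2 * Real.pi / p) * x 1, Real.sin (2 * Real.pi / p) * x 0 + Real.cos (2 * Real.pi / p) * x 1, x 2] - x₀) = WithLp.toLp 2 ![Real.cos (2 * Real.pi / p) * u₀ x 0 - Real.sin (2 * Real.pi / p) * u₀ x 1, Real.sin (2 * Real.pi / p) * u₀ x 0 + Real.cos (2 * Real.pi / p) * u₀ x 1, u₀ x 2] := by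
    filter_upwards [hfix] with x hx
    simpa only [Literature.Analysis.FluidPDE.rescaleData, one_smul] using hx
  have hx₀ : x₀ 2 = 0 :=
    Summit.NavierStokesRegularity.NavierStokesRegularity.Theorems.stub_liftShiftRigidity p u₀ hL3 hne x₀ hfix'
  obtain ⟨u₁, g₁, hmin₁, hfix₁⟩ :=
    Summit.NavierStokesRegularity.NavierStokesRegularity.Theorems.stub_liftRecentre ν p h2p u₀ g hmin x₀ hx₀ hfix'
  refine ⟨p, hNp, h2p, fun ε hε => ⟨u₁, g₁, hmin₁.1, hmin₁.2.1, hmin₁.2.2.1, hmin₁.2.2.2.2, ?_, hfix₁⟩⟩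
  rw [hmin₁.2.2.2.1]
  exact ENNReal.lt_add_right hfin.ne hε.ne'

/-- The written-out conclusion IS the crux decl (definitional, `Iff.rfl`). -/
theorem MinimalDatumPFold_iff_written :
    Summit.NavierStokesRegularity.NavierStokesRegularity.Theses.AxisymmetricExtremality.MinimalDatumPFold ↔
      (∀ ν : ℝ, 0 < ν → (∃ v₀ : EuclideanSpace ℝ (Fin 3) → EuclideanSpace ℝ (Fin 3), ContDiff ℝ (⊤ : ℕ∞) v₀ ∧ Literature.Analysis.FluidPDE.NSWave0.IsDivFree v₀ ∧ Literature.Analysis.FluidPDE.HasRapidSpatialDecay v₀ ∧ ¬ ∃ (u : ℝ → EuclideanSpace ℝ (Fin 3) → EuclideanSpace ℝ (Fin 3)) (p : ℝ → EuclideanSpace ℝ (Fin 3) → ℝ), Literature.Analysis.FluidPDE.IsSmoothOnHalfSpace u ∧ Literature.Analysis.FluidPDE.IsSmoothOnHalfSpace p ∧ Literature.Analysis.FluidPDE.IsNavierStokesSolution ν 0 v₀ u p ∧ Literature.Analysis.FluidPDE.HasBoundedEnergy u) → ∀ N : ℕ, ∃ p : ℕ, N ≤ p ∧ 2 ≤ p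 ∧ ∃ (u₀ : EuclideanSpace ℝ (Fin 3) → EuclideanSpace ℝ (Fin 3)) (g : Literature.Analysis.FunctionSpaces.HomSobolev (EuclideanSpace ℝ (Fin 3)) (EuclideanSpace ℂ (Fin 3)) (1 / 2 : ℝ)), Literature.Analysis.FluidPDE.IsMinimalBlowupDatum ν u₀ g ∧ ∀ x : EuclideanSpace ℝ (Fin 3), u₀ (WithLp.toLp 2 ![Real.cos (2 * Real.pi / p) * x 0 - Real.sin (2 * Real.pi / p) * x 1, Real.sin (2 * Real.pi / p) * x 0 + Real.cos (2 * Real.pi / p) * x 1, x 2]) = WithLp.toLp 2 ![Real.cos (2 * Real.pi / p) * u₀ x 0 - Real.sin (2 * Real.pi / p) * u₀ x 1, Real.sin (2 * Real.pi / p) * u₀ x 0 + Real.cos (2 * Real.pi / p) * u₀ x 1, u₀ x 2]) :=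
  Iff.rfl

/-- THE SKELETON THEOREM (registered target): the crux `AxisymmetricExtremality.MinimalDatumPFold` BY NAME,
no hypotheses, from the three DECLARED stubs through the sorry-free composition — `sorryAx` is reached
exactly through the stubs (the only sorries of the file). -/
theorem MinimalDatumPFold_of :
    Summit.NavierStokesRegularity.NavierStokesRegularity.Theses.AxisymmetricExtremality.MinimalDatumPFold :=
  MinimalDatumPFold_iff_written.mpr
    (MinimalDatumPFold_of_sigs stub_symmGapClosing stub_nearMinimalLimit stub_symmetryDefectInLimit)

end Summit.NavierStokesRegularity.NavierStokesRegularity.Cruxes.MinimalDatumPFold.SymmetricGap
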